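import Summits.QuantumAdvantage.QuantumAdvantage.Theorems.ArithStatLadderAvgFaceBeyondPriorMirrorRankRare
import Literature.NumberTheory.QuadraticFields.ThreeTorsionMeanLocalAtThreeProofs

/-!
# Route `ArithStatLadder`, support item `MirrorRankRare` (stmt-QuantumAdvantage-15004): the closing step

`MirrorRankRare` says: for every `ε > 0`, eventually in `n`, at most `(1/6 + ε)·#𝒟ₙ` of the `d` in the
dyadic block `𝒟ₙ = {2^(n-1) ≤ d < 2ⁿ : −d fundamental}` have non-trivial `3`-torsion in the class
group of the MIRROR field `ℚ(√3d)` (discriminant `D⁺(d) = d/3` if `3 ∣ d`, `3d` otherwise).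

The mathematics is entirely in `Theorems/ArithStatLadderAvgFaceBeyondPriorMirrorRankRare.lean`
(`AvgFaceBeyondPrior.Mirror.stub_mirrorRankRare`: transport `d ↦ D⁺(d)` onto the two Bhargava–Varma
families of positive fundamental discriminants with `3` ramified / unramified, window differencing,
Markov with `#Cl₃ ≠ 1 ⇒ #Cl₃ ≥ 3`), which takes the two named facts of
`Literature/NumberTheory/QuadraticFields/ThreeTorsionMeanLocalAtThree.lean` as hypotheses. Of these,
`bv_count_posFundDiscrs_localAtThree` (Bhargava–Varma 2016, Lemma 37 (a): both families have positive
density) is DISCHARGED in the tree (`bv_count_posFundDiscrs_localAtThree_holds`,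
`ThreeTorsionMeanLocalAtThreeProofs.lean`); the other, `bv_threeTorsion_mean_localAtThree`
(Bhargava–Varma 2016, Cor. 4 (b) = Davenport–Heilbronn for real quadratic fields with a local condition
at `3`: mean `4/3` of `#Cl₃`), is not — its printed proof needs Hasse's class-field-theoretic bijection
(cubic fields of discriminant `D` ↔ index-`3` subgroups of `Cl(ℚ(√D))`) and Davenport's
geometry-of-numbers count of cubic orders with congruence conditions, neither of which is in Mathlib or
the tree (see the module docstring of `ThreeTorsionMeanLocalAtThreeProofs.lean`, which reduces the fact
to exactly these two inputs).

This file therefore records the item's honest state: `MirrorRankRare` typed LITERALLY as the route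
declaration, conditional on the single remaining named fact. The day
`bv_threeTorsion_mean_localAtThree_holds` lands, `MirrorRankRare_proof` is the one-liner
`MirrorRankRare_of_bv_threeTorsion_mean_localAtThree bv_threeTorsion_mean_localAtThree_holds`.
-/

set_option linter.dupNamespace false -- D-0017: single-problem summit ⇒ `QuantumAdvantage.QuantumAdvantage` by design

namespace Summit.QuantumAdvantage.QuantumAdvantage.Theorems.ArithStatLadder

open Literature.NumberTheory.QuadraticFields
open Summit.QuantumAdvantage.QuantumAdvantage.Theses.ArithStatLadder

/-- **`MirrorRankRare` from Bhargava–Varma Cor. 4 (b).** Assuming the named fact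
`bv_threeTorsion_mean_localAtThree` (mean `4/3` of `#Cl₃(D)` over the positive fundamental `D < X`
with `3 ∣ D`, resp. `3 ∤ D` — Bhargava–Varma 2016, Cor. 4 (b)), the route statement
`MirrorRankRare` holds: for every `ε > 0`, eventually in `n`,
`#{d ∈ 𝒟ₙ : #Cl₃(D⁺(d)) ≠ 1} ≤ (1/6 + ε)·#𝒟ₙ`. The block `𝒟ₙ` of the route is definitionally
`AvgFaceBeyondPrior.Negative.fundBlock n`, so this is `Mirror.stub_mirrorRankRare` fed with the
hypothesis and the proved density fact `bv_count_posFundDiscrs_localAtThree_holds`.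
[cite: BhargavaVarma2016, Cor. 4 (b), Lemma 37 (a)] -/
theorem MirrorRankRare_of_bv_threeTorsion_mean_localAtThree
    (hBV : bv_threeTorsion_mean_localAtThree) : MirrorRankRare := by
  unfold MirrorRankRare
  exact Summit.QuantumAdvantage.QuantumAdvantage.Theorems.AvgFaceBeyondPrior.Mirror.stub_mirrorRankRare hBV
    bv_count_posFundDiscrs_localAtThree_holds

end Summit.QuantumAdvantage.QuantumAdvantage.Theorems.ArithStatLadder
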